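import Literature.AnabelianGeometry.EtaleTheta.Discharge.Sec4RootTwistLaws

/-!
# [EtTh] §5 / [FrdI] Thm 5.2 (i): the unit discrepancy of a transported pair of base-equivalent pre-steps is INTRINSIC (model)

Mochizuki, *The étale theta function …*, Publ. RIMS **45** (2009) [cite: MochizukiEtTh2009, Thm 5.7 p.329–330 (PDF pp.103–104);
Def 4.1 (i) p.312 (PDF p.86)]; *The geometry of Frobenioids I* [cite: MochizukiFrdI2008, Thm. 5.2 (i) p.100] (morphisms of the
model Frobenioid: `u_{ψ∘φ} = Base(φ)^* u_ψ · u_φ^{deg_Fr ψ}`).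

abc-iut cell, layer L2, seat abc-iut-L2-d4 (gen 5; node `EtTh:Thm5.7`, row R219 — the brick «R-Cδ» of
`HOME/staging/L2/L2-d4/SHAPES-Thm57-residual-C.md`).  PROOF-ONLY (0 defs) over abc-iut-L1's model Frobenioid API
(`ModelFrobenioid.unit_comp_pull`, `pull_baseMap_of_mem_units`, `hom_ext`, `div_eq_one_of_mem_units`).

WHY.  In the proof of Thm. 5.7 (p.329–330) `Ψ` carries the base-equivalent pair of pre-steps `(s^⊓_N, s^⊔_N)` to
`(e ≫ s^⊓_N ≫ D_c, e ≫ s^⊔_N ≫ D_p)` for units `e ∈ O^×(A_N)`, `D_c, D_p ∈ O^×(B_N)`; only the DISCREPANCY `u := D_c⁻¹·D_p` matters.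
Two producers of such data coexist in the tree for the same identifications (abc-iut-f-121's coherent datum with `e = 1`, `D_c = 1`
— p438241/p443132 — and abc-iut-w5-d245's Kummer-transport datum with its [FrdI] Prop. 5.6 unit `e₁` — p437125); the final knit of
Thm. 5.7 (anchored family, p442166; Kummer-rigidity form, p445072) uses the first for the descent and the second for the Kummer
cocycle (T3, p415021), so it needs: **the discrepancy does not depend on the datum**.  At the model this is [FrdI] Thm. 5.2 (i)
bookkeeping: a unit `ε` of `A` pushes forward along a pre-step `s : A → B` to the unit `δ` of `B` with `ε ≫ s = s ≫ δ`, and `u_δ` is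
`((Base s)^*)⁻¹ u_ε` — it depends on `Base(s)` ONLY; base-equivalent pre-steps push every unit forward to the SAME unit.
* `TemperedFrobenioid.unit_eq_pull_of_over` — `ε ≫ s = s ≫ δ` (`ε`, `δ` units, `s` linear) ⇒ `u_ε = Base(s)^* u_δ`;
* `TemperedFrobenioid.eq_of_over_of_baseMap_eq` — `ε ≫ s′ = s′ ≫ δ′`, `ε ≫ s″ = s″ ≫ δ″`, `Base s′ = Base s″` an isomorphism ⇒ `δ′ = δ″`;
* `TemperedFrobenioid.discrepancy_eq_of_transports` — if `(s′, s″ ≫ w)` and `(e ≫ s′ ≫ D_c, e ≫ s″ ≫ D_p)` are two re-anchorings of the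
  same transported pair (i.e. `s′ ≫ D_c⁻¹ = e ≫ s′` and `s″ ≫ w ≫ D_c⁻¹ = e ≫ s″ ≫ D_p`, all of `e, w, D_c, D_p` units), then `w = D_p`
  (`O^×(B)` abelian) — the shape consumed by the Thm. 5.7 knit.
HONEST FRAMING: kernel-checked identities of the model vocabulary; refereed pre-IUT material ([FrdI] Thm. 5.2, [EtTh] §5); nothing
here bears on [IUTchIII] Cor. 3.12 or takes a side; typed ≠ proved for any genuine datum. -/

namespace Literature.AnabelianGeometry.EtaleTheta

open CategoryTheory Opposite Literature.AlgebraicGeometry.Frobenioids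

namespace TemperedFrobenioid

universe u₀ v₀ u v w

variable {D₀ : Type u₀} [Category.{v₀} D₀] {V : FrdIMonoidStub.{w}} {T : RealifiedDivisorMonoids (D₀ := D₀) V}
  {D : Type u} [Category.{v} D] {VD : FrdICatStub.{u, v, w} D} (C : TemperedFrobenioid T D VD)

/-- **A unit pushed forward along a linear morphism** ([FrdI] Thm. 5.2 (i)): if `ε ∈ O^×(A)`, `δ ∈ O^×(B)` and `s : A → B` is
linear with `ε ≫ s = s ≫ δ`, then `u_ε = Base(s)^* u_δ` in `B(A_D)` (read the unit coordinates of both sides and cancel `u_s`).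
[cite: MochizukiFrdI2008, Thm. 5.2 (i) p.100] -/
theorem unit_eq_pull_of_over {A B : C.category} {s : A ⟶ B} (hs : ModelFrobenioid.degFr s = 1) {ε : Aut A}
    (hε : ε ∈ ModelFrobenioid.units A) {δ : Aut B} (hδ : δ ∈ ModelFrobenioid.units B) (h : ε.hom ≫ s = s ≫ δ.hom) :
    ModelFrobenioid.unit ε.hom = pull C.ratFnFunctor (ModelFrobenioid.baseMap s) (ModelFrobenioid.unit δ.hom) := by
  have e := congrArg ModelFrobenioid.unit h
  rw [ModelFrobenioid.unit_comp_pull, ModelFrobenioid.unit_comp_pull, ModelFrobenioid.pull_baseMap_of_mem_units hε, hs,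
    hδ.2, PNat.one_coe, pow_one, pow_one, mul_comm] at e
  exact (C.isUnit_ratFnFunctor T.isUnit_BΛ A (ModelFrobenioid.unit s)).mul_right_cancel e

/-- **Base-equivalent linear base-isomorphisms push every unit forward to the SAME unit** ([FrdI] Thm. 5.2 (i); `Φ` divisorial so
that `Div = 0` on `O^×`): `ε ≫ s′ = s′ ≫ δ′`, `ε ≫ s″ = s″ ≫ δ″`, `Base s′ = Base s″` an isomorphism, `ε, δ′, δ″` units ⇒ `δ′ = δ″`.
[cite: MochizukiFrdI2008, Thm. 5.2 (i) p.100] -/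
theorem eq_of_over_of_baseMap_eq (hΦd : Objectwise (fun M _ => IsDivisorial M) C.divisorMonoid) {A B : C.category}
    {s' s'' : A ⟶ B} (hs' : ModelFrobenioid.degFr s' = 1) (hs'' : ModelFrobenioid.degFr s'' = 1)
    (hb : ModelFrobenioid.baseMap s' = ModelFrobenioid.baseMap s'') [IsIso (ModelFrobenioid.baseMap s'')] {ε : Aut A}
    (hε : ε ∈ ModelFrobenioid.units A) {δ' δ'' : Aut B} (hδ' : δ' ∈ ModelFrobenioid.units B)
    (hδ'' : δ'' ∈ ModelFrobenioid.units B) (h' : ε.hom ≫ s' = s' ≫ δ'.hom) (h'' : ε.hom ≫ s'' = s'' ≫ δ''.hom) :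
    δ' = δ'' := by
  have e' := C.unit_eq_pull_of_over hs' hε hδ' h'
  have e'' := C.unit_eq_pull_of_over hs'' hε hδ'' h''
  rw [hb] at e'
  have hu : ModelFrobenioid.unit δ'.hom = ModelFrobenioid.unit δ''.hom :=
    pull_injective_of_isIso C.ratFnFunctor (ModelFrobenioid.baseMap s'') (e'.symm.trans e'')
  exact Iso.ext (ModelFrobenioid.hom_ext (hδ'.2.trans hδ''.2.symm) (hδ'.1.trans hδ''.1.symm)
    (by rw [ModelFrobenioid.div_eq_one_of_mem_units (hΦd B.base).isSharp hδ',
      ModelFrobenioid.div_eq_one_of_mem_units (hΦd B.base).isSharp hδ'']) hu)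

/-- **The unit discrepancy of a transported pair is intrinsic** (Thm. 5.7, p.329–330: `u := D_c⁻¹·D_p`).  For a base-equivalent
pair of linear base-isomorphisms `s′, s″ : A → B` (e.g. the pre-steps `(s^⊓_N, s^⊔_N)`), two re-anchorings `(s′, s″ ≫ w)` and
`(e ≫ s′ ≫ D_c, e ≫ s″ ≫ D_p)` of the same transported pair — `s′ ≫ D_c⁻¹ = e ≫ s′`, `s″ ≫ w ≫ D_c⁻¹ = e ≫ s″ ≫ D_p`, with
`e ∈ O^×(A)` and `w, D_c, D_p ∈ O^×(B)` — have the same discrepancy: `w = D_p` (`O^×(B)` abelian, `D_c⁻¹` being the push-forward of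
`e` along both `s′` and `s″`).  [cite: MochizukiEtTh2009, Thm 5.7 p.329–330 (PDF pp.103–104)] -/
theorem discrepancy_eq_of_transports (hΦd : Objectwise (fun M _ => IsDivisorial M) C.divisorMonoid) {A B : C.category}
    {s' s'' : A ⟶ B} (hs' : ModelFrobenioid.degFr s' = 1) (hs'' : ModelFrobenioid.degFr s'' = 1)
    (hb : ModelFrobenioid.baseMap s' = ModelFrobenioid.baseMap s'') [IsIso (ModelFrobenioid.baseMap s'')] {e : Aut A}
    (he : e ∈ ModelFrobenioid.units A) {w Dc Dp : Aut B} (hw : w ∈ ModelFrobenioid.units B)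
    (hDc : Dc ∈ ModelFrobenioid.units B) (hDp : Dp ∈ ModelFrobenioid.units B)
    (h' : s' ≫ Dc.inv = e.hom ≫ s') (h'' : s'' ≫ w.hom ≫ Dc.inv = e.hom ≫ s'' ≫ Dp.hom) : w = Dp := by
  -- `e` pushes forward along `s′` to `D_c⁻¹` and along `s″` to `D_p⁻¹·D_c⁻¹·w`
  have h₁ : e.hom ≫ s' = s' ≫ (Dc⁻¹).hom := h'.symm
  have h₂ : e.hom ≫ s'' = s'' ≫ (Dp⁻¹ * (Dc⁻¹ * w)).hom := by
    have h3 : (s'' ≫ w.hom ≫ Dc.inv) ≫ Dp.inv = e.hom ≫ s'' := by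
      rw [h'', Category.assoc, Category.assoc, Iso.hom_inv_id, Category.comp_id]
    rw [← h3]
    simp only [Aut.Aut_mul_def, Aut.Aut_inv_def, Iso.trans_hom, Iso.symm_hom, Category.assoc]
  have hkey := C.eq_of_over_of_baseMap_eq hΦd hs' hs'' hb he (inv_mem hDc) (mul_mem (inv_mem hDp) (mul_mem (inv_mem hDc) hw))
    h₁ h₂
  -- `D_c⁻¹ = D_p⁻¹·D_c⁻¹·w` in the abelian group `O^×(B)`
  have hcomm : Dc⁻¹ * w = w * Dc⁻¹ := by
    have := (ModelFrobenioid.isMulCommutative_units B).is_comm.comm ⟨Dc⁻¹, inv_mem hDc⟩ ⟨w, hw⟩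
    exact congrArg Subtype.val this
  rw [hcomm, ← mul_assoc] at hkey
  -- `Dc⁻¹ = Dp⁻¹ * w * Dc⁻¹` ⇒ `1 = Dp⁻¹ * w` ⇒ `w = Dp`
  have h1 : Dp⁻¹ * w = 1 := by
    have := congrArg (· * Dc) hkey
    simpa [mul_assoc] using this.symm
  rw [inv_mul_eq_one] at h1
  exact h1.symm

end TemperedFrobenioid

end Literature.AnabelianGeometry.EtaleTheta
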